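import Summits.BirchSwinnertonDyer.BirchSwinnertonDyer.Theorems.ManinLocalTwoThreeShimuraIndexSquareBound
import Summits.BirchSwinnertonDyer.BirchSwinnertonDyer.Theorems.ManinLocalTwoThreeShimuraQuotientHeckeAtFour
import HarnessLib

/-!
# TRACELESS SQUARES: an odd square prime factor `q² ∣ N` forces `Λ₁(f) = Λ₀(f)` — except for the three named cells
# `(q, N mod 4, a₂) = (3, odd, 0)`, `(3, 2 ∥ N, −1)`, `(5, odd, −2)`

Summit `BirchSwinnertonDyer`, route `ManinLocalTwoThree` (cell bsd-f2-manin), crux C2 `ManinOddAtFour`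
(stmt-BirchSwinnertonDyer-22967; the `q = 3` half is C3's habitat `ManinPrimeToThreeAtNine`, stmt-BirchSwinnertonDyer-22968).
Planner seat bsd-f2-manin-es (LENS es: the Shimura covering read on period lattices), gen 46; TURNKEY T-es-113 for the C2/C3 LEAD
(prover bsd-line-manin23-p1).  Three-line corollaries of the in-tree SQUARE BOUND (T-es-111, `…ShimuraIndexSquareBound`:
`[Λ₀ : Λ₁] ∣ m²` whenever `mΛ₀ ⊆ Λ₁`, and the `a₂`-menu `∣ 25 ∨ ∣ 16 ∨ ∣ 9 ∨ ∣ 4`) and of LEAD's `4 ∣ N` theorem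
(`…ShimuraQuotientHeckeAtFour.periodLatticeGamma1_eq_of_four_dvd_of_odd_sq_dvd`).  In-tree imports only.

THE CLASSIFICATION (globally minimal `W`, any `X₀(N)`-datum `D`, `q` an odd prime with `q² ∣ N`; all UNCONDITIONAL):
* `q ≥ 7` ⟹ `Λ₁(f) = Λ₀(f)` at EVERY level (`[Λ₀ : Λ₁] ∣ q²` and `q ∤ [Λ₀ : Λ₁] ≤ 25`): `49, 98, 121, 147, 169, 196, 242, 245,
  289, 294, 338, 343, 361, 363, 392, 441, 484, 490, …` (§1).
* `q = 5`: `2 ∣ N` ⟹ `Λ₁ = Λ₀` (`[Λ₀ : Λ₁] ∣ 25` and `∣ 4 ∨ ∣ 9`): `50, 100, 150, 200, 250, 300, 350, 400, 450, …`; `2 ∤ N` ⟹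
  `Λ₁ = Λ₀` unless `a₂(W) = −2`, when `[Λ₀ : Λ₁] ∣ 25` (§2).
* `q = 3`: `4 ∣ N` ⟹ `Λ₁ = Λ₀` (LEAD, re-read in index currency); `2 ∥ N` ⟹ `Λ₁ = Λ₀` unless `a₂(f) = −1`, when `[Λ₀ : Λ₁] ∣ 9`;
  `2 ∤ N` ⟹ `Λ₁ = Λ₀` unless `a₂(W) = 0`, when `[Λ₀ : Λ₁] ∣ 9` (§3).
* §4 `relIndex_eq_one_or_exceptional_of_odd_sq_dvd`: the four lines as ONE theorem.
So the local invariant that decides whether a square prime factor kills the Shimura index is `(q, v₂(N), a₂)` and nothing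
else; in the three exceptional cells the index is a power of `q ∈ {3, 5}` bounded by `q²` (and by `φ(N)/2`, T-es-108).

CENSUS FACE (es census E15, `HOME/es/E15-LATTICE-INDEX-v1.tsv`, 1025 optimal classes `N ≤ 250`): 281 classes have an odd square
prime factor; by cell — `q ≥ 7`: 59 classes, all index `1`; `q = 5`, `2 ∣ N`: 36, all `1`; `q = 5`, `2 ∤ N`: 25, all `1`;
`q = 3`, `4 ∣ N`: 42, all `1`; `q = 3`, `2 ∥ N`: 61, index `> 1` only at `54a1 ↦ 3` (`a₂ = −1` ✓); `q = 3`, `2 ∤ N`: 76, index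
`> 1` only at `27a1 ↦ 3` (`a₂(27a1) = 0` ✓, CM by `ℤ[ζ₃]`, `2` inert).  Zero rows outside the classification.

HONEST FRAMING.  Bookkeeping on top of T-es-111 (rank-`2` square bound = shadow of [LingOesterle1991, §1] / [Stevens1989, §2])
and the Atkin–Lehner vanishing `a_q = 0` for `q² ∣ N`; the Hasse bound at `2` supplies the coprimality.  New in the tree as
stated; the two-traceless-primes case (`p²q² ∣ N ⟹ Λ₁ = Λ₀`) is the Literature's `gamma1LatticeEqOfTwoTracelessPrimes_holds` and is
NOT restated.  C2, C3, Manin's conjecture and BSD are NOT proved by this file.  No definitions, no sorry.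
[cite: LingOesterle1991, §1 and Thm. 6] [cite: AtkinLehner1970, Thm. 3] [cite: Stevens1989, §2] [cite: SilvermanAEC2009, Thm. V.1.1]
[cite: Manin1972, Thm. 1.6]
-/

set_option autoImplicit false
-- the summit-side namespace `Summit.BirchSwinnertonDyer.BirchSwinnertonDyer.…` is the tree's (summit = sub-problem)
set_option linter.dupNamespace false

noncomputable section

open scoped Classical MatrixGroups

open CongruenceSubgroup Matrix.SpecialLinearGroup ModularGroup
open Literature.NumberTheory.EllipticCurves Literature.NumberTheory.EllipticCurves.ModularForms

namespace Summit.BirchSwinnertonDyer.BirchSwinnertonDyer.Theorems.ManinLocalTwoThree.ShimuraIndex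

/-- `i ∣ a`, `i ∣ b`, `gcd(a, b) = 1` ⟹ `i = 1`. -/
private theorem eq_one_of_dvd_of_dvd {i a b : ℕ} (ha : i ∣ a) (hb : i ∣ b) (h : Nat.gcd a b = 1) : i = 1 :=
  Nat.dvd_one.mp (h ▸ Nat.dvd_gcd ha hb)

section AnyCurve

variable {W₀ : WeierstrassCurve ℚ} {N : ℕ} [NeZero N]

open Summit.BirchSwinnertonDyer.BirchSwinnertonDyer.Theorems.ManinLocalTwoThree.ShimuraIndexAtTwo
open Summit.BirchSwinnertonDyer.BirchSwinnertonDyer.Theorems.ManinLocalTwoThree.SigmaHabitat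

/-! ## §2a/§3a The even-level halves (any curve `W₀`, any datum) -/

/-- **`25 ∣ N`, `2 ∣ N` ⟹ `[Λ₀(f) : Λ₁(f)] = 1`** for every `X₀(N)`-datum (`∣ 25` against `∣ 4 ∨ ∣ 9`): levels `50, 100, 150, 200,
250, 300, 350, 400, 450, 550, …` (E15: 36 classes, all index `1`). [cite: LingOesterle1991, §1 and Thm. 6] [cite: AtkinLehner1970, Thm. 3] -/
theorem relIndex_eq_one_of_twentyFive_dvd_of_two_dvd (D₀ : ModularParametrizationData W₀ N) (h25 : 5 ^ 2 ∣ N)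
    (h2 : 2 ∣ N) : (periodLatticeGamma1 D₀.f).relIndex (periodLattice D₀.f) = 1 := by
  have h := relIndex_dvd_sq_of_sq_dvd D₀ Nat.prime_five h25
  rcases relIndex_dvd_four_or_nine_of_two_dvd D₀ h2 with h' | h'
  · exact eq_one_of_dvd_of_dvd h h' (by norm_num)
  · exact eq_one_of_dvd_of_dvd h h' (by norm_num)

/-- `25 ∣ N`, `2 ∣ N` ⟹ `Λ₁(f) = Λ₀(f)`. [cite: LingOesterle1991, §1 and Thm. 6] -/
theorem periodLatticeGamma1_eq_of_twentyFive_dvd_of_two_dvd (D₀ : ModularParametrizationData W₀ N) (h25 : 5 ^ 2 ∣ N)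
    (h2 : 2 ∣ N) : periodLatticeGamma1 D₀.f = periodLattice D₀.f :=
  le_antisymm (periodLatticeGamma1_le_periodLattice D₀.f)
    (AddSubgroup.relIndex_eq_one.mp (relIndex_eq_one_of_twentyFive_dvd_of_two_dvd D₀ h25 h2))

/-- **`a₂(f) = 1` at even level ⟹ `[Λ₀(f) : Λ₁(f)] = 1`** for every datum (THEOREM W at `2`: `(a₂ − 2)Λ₀ = −Λ₀ ⊆ Λ₁`).
[cite: LingOesterle1991, Thm. 6] [cite: AtkinLehner1970, Thm. 3] -/
theorem relIndex_eq_one_of_cuspCoeff_two_eq_one_datum (D₀ : ModularParametrizationData W₀ N) (h2 : 2 ∣ N)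
    (h1 : cuspCoeff D₀.f 2 = 1) : (periodLatticeGamma1 D₀.f).relIndex (periodLattice D₀.f) = 1 := by
  rw [AddSubgroup.relIndex_eq_one]
  intro z hz
  have h := sub_two_mul_mem_periodLatticeGamma1_of_two_dvd D₀.isNewformOf.1 h2 hz
  rw [h1, show ((1 : ℂ) - 2) * z = -z by ring] at h
  exact neg_mem_iff.mp h

/-- **`9 ∣ N`, `2 ∥ N` ⟹ `(a₂(f) = 1 ∧ [Λ₀ : Λ₁] = 1) ∨ (a₂(f) = −1 ∧ [Λ₀ : Λ₁] ∣ 9)`** for every datum.  E15: 61 classes, index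
`> 1` only at `54a1 ↦ 3` (`a₂ = −1`). [cite: LingOesterle1991, §1 and Thm. 6] [cite: AtkinLehner1970, Thm. 3] -/
theorem relIndex_eq_one_or_dvd_nine_of_two_dvd_of_not_four_dvd (D₀ : ModularParametrizationData W₀ N) (h9 : 3 ^ 2 ∣ N)
    (h2 : 2 ∣ N) (h4 : ¬ 2 ^ 2 ∣ N) :
    (cuspCoeff D₀.f 2 = 1 ∧ (periodLatticeGamma1 D₀.f).relIndex (periodLattice D₀.f) = 1) ∨
      (cuspCoeff D₀.f 2 = -1 ∧ (periodLatticeGamma1 D₀.f).relIndex (periodLattice D₀.f) ∣ 9) := by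
  obtain ⟨e, he, hcase⟩ := exists_cuspCoeff_two_eq_of_two_dvd D₀.isNewformOf.1 h2
  rcases hcase with ⟨h4', -⟩ | ⟨-, rfl | rfl⟩
  · exact absurd h4' h4
  · exact Or.inl ⟨by simpa using he, relIndex_eq_one_of_cuspCoeff_two_eq_one_datum D₀ h2 (by simpa using he)⟩
  · exact Or.inr ⟨by simpa using he, by simpa using relIndex_dvd_sq_of_sq_dvd D₀ Nat.prime_three h9⟩

/-- `9 ∣ N`, `4 ∣ N` ⟹ `[Λ₀(f) : Λ₁(f)] = 1` — LEAD's `periodLatticeGamma1_eq_of_four_dvd_of_odd_sq_dvd` in index currency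
(levels `36, 72, 108, 144, 180, 216, …`; E15: 42 classes, all `1`). [cite: LingOesterle1991, Thm. 6] -/
theorem relIndex_eq_one_of_nine_dvd_of_four_dvd (D₀ : ModularParametrizationData W₀ N) (h9 : 3 ^ 2 ∣ N)
    (h4 : 2 ^ 2 ∣ N) : (periodLatticeGamma1 D₀.f).relIndex (periodLattice D₀.f) = 1 :=
  AddSubgroup.relIndex_eq_one.mpr
    (periodLatticeGamma1_eq_of_four_dvd_of_odd_sq_dvd D₀ h4 Nat.prime_three (by norm_num) h9).ge

end AnyCurve

section Minimal

open Summit.BirchSwinnertonDyer.BirchSwinnertonDyer.Theorems.ManinLocalTwoThree.ShimuraIndexAtTwo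
open Summit.BirchSwinnertonDyer.BirchSwinnertonDyer.Theorems.ManinLocalTwoThree.SigmaHabitat

variable (W : WeierstrassCurve ℚ) [W.IsElliptic] [W.IsGloballyMinimal] {N : ℕ} [NeZero N]

/-! ## §1 `q ≥ 7`: a square prime factor `q² ∣ N` kills the Shimura index at every level -/

/-- **`q ≥ 7` prime, `q² ∣ N` ⟹ `[Λ₀(f) : Λ₁(f)] = 1`** for every datum of a globally minimal curve, at EVERY level
(`[Λ₀ : Λ₁] ∣ q²` by `a_q = 0`, and `q ∤ [Λ₀ : Λ₁]` by the `a₂`-menu `∣ 25 ∨ ∣ 16 ∨ ∣ 9 ∨ ∣ 4`).  E15: 59 classes, all index `1`.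
[cite: LingOesterle1991, §1 and Thm. 6] [cite: AtkinLehner1970, Thm. 3] [cite: SilvermanAEC2009, Thm. V.1.1] -/
theorem relIndex_eq_one_of_sq_dvd_of_seven_le (D : ModularParametrizationData W N) {q : ℕ} (hq : q.Prime) (h7 : 7 ≤ q)
    (hsq : q ^ 2 ∣ N) : (periodLatticeGamma1 D.f).relIndex (periodLattice D.f) = 1 := by
  have hd := relIndex_dvd_sq_of_sq_dvd D hq hsq
  have hnd := not_dvd_relIndex_of_seven_le W D hq h7
  obtain ⟨m, -, hm⟩ := (Nat.dvd_prime_pow hq).mp hd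
  rcases m with _ | m
  · simpa using hm
  · exact absurd (hm ▸ dvd_pow_self q (Nat.succ_ne_zero m)) hnd

/-- `q ≥ 7` prime, `q² ∣ N` ⟹ `Λ₁(f) = Λ₀(f)` (minimal `W`, every datum, every level). [cite: LingOesterle1991, §1 and Thm. 6] -/
theorem periodLatticeGamma1_eq_of_sq_dvd_of_seven_le (D : ModularParametrizationData W N) {q : ℕ} (hq : q.Prime)
    (h7 : 7 ≤ q) (hsq : q ^ 2 ∣ N) : periodLatticeGamma1 D.f = periodLattice D.f :=
  le_antisymm (periodLatticeGamma1_le_periodLattice D.f)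
    (AddSubgroup.relIndex_eq_one.mp (relIndex_eq_one_of_sq_dvd_of_seven_le W D hq h7 hsq))

/-! ## §2 `q = 5` at odd level -/

/-- **`25 ∣ N`, `2 ∤ N` ⟹ `[Λ₀(f) : Λ₁(f)] = 1 ∨ (a₂(W) = −2 ∧ [Λ₀(f) : Λ₁(f)] ∣ 25)`** (minimal `W`).  E15: 25 classes, all
index `1`. [cite: LingOesterle1991, §1 and Thm. 6] [cite: SilvermanAEC2009, Thm. V.1.1] -/
theorem relIndex_eq_one_or_dvd_twentyFive_of_not_two_dvd (D : ModularParametrizationData W N) (h25 : 5 ^ 2 ∣ N)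
    (hodd : ¬ 2 ∣ N) :
    (periodLatticeGamma1 D.f).relIndex (periodLattice D.f) = 1 ∨
      (W.frobeniusTrace 2 = -2 ∧ (periodLatticeGamma1 D.f).relIndex (periodLattice D.f) ∣ 25) := by
  have h := relIndex_dvd_sq_of_sq_dvd D Nat.prime_five h25
  rcases relIndex_dvd_of_not_two_dvd W D hodd with ⟨ha, h'⟩ | ⟨-, h'⟩ | ⟨-, h'⟩ | ⟨-, h'⟩ | ⟨-, h'⟩
  · exact Or.inr ⟨ha, h'⟩
  · exact Or.inl (eq_one_of_dvd_of_dvd h h' (by norm_num))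
  · exact Or.inl (eq_one_of_dvd_of_dvd h h' (by norm_num))
  · exact Or.inl (eq_one_of_dvd_of_dvd h h' (by norm_num))
  · exact Or.inl h'

/-- `25 ∣ N`, `2 ∤ N`, `a₂(W) ≠ −2` ⟹ `Λ₁(f) = Λ₀(f)`. [cite: LingOesterle1991, §1 and Thm. 6] -/
theorem periodLatticeGamma1_eq_of_twentyFive_dvd_of_frobeniusTrace_two_ne (D : ModularParametrizationData W N)
    (h25 : 5 ^ 2 ∣ N) (hodd : ¬ 2 ∣ N) (ha : W.frobeniusTrace 2 ≠ -2) : periodLatticeGamma1 D.f = periodLattice D.f := by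
  rcases relIndex_eq_one_or_dvd_twentyFive_of_not_two_dvd W D h25 hodd with h | ⟨ha', -⟩
  · exact le_antisymm (periodLatticeGamma1_le_periodLattice D.f) (AddSubgroup.relIndex_eq_one.mp h)
  · exact absurd ha' ha

/-! ## §3 `q = 3` at odd level -/

/-- **`9 ∣ N`, `2 ∤ N` ⟹ `[Λ₀(f) : Λ₁(f)] = 1 ∨ (a₂(W) = 0 ∧ [Λ₀(f) : Λ₁(f)] ∣ 9)`** (minimal `W`; C3's odd levels `27, 45, 63,
99, 117, 135, 153, 171, 189, 207, 225, 243, …`).  E15: 76 classes, index `> 1` only at `27a1 ↦ 3` (`a₂ = 0`).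
[cite: LingOesterle1991, §1 and Thm. 6] [cite: SilvermanAEC2009, Thm. V.1.1] -/
theorem relIndex_eq_one_or_dvd_nine_of_not_two_dvd (D : ModularParametrizationData W N) (h9 : 3 ^ 2 ∣ N)
    (hodd : ¬ 2 ∣ N) :
    (periodLatticeGamma1 D.f).relIndex (periodLattice D.f) = 1 ∨
      (W.frobeniusTrace 2 = 0 ∧ (periodLatticeGamma1 D.f).relIndex (periodLattice D.f) ∣ 9) := by
  have h := relIndex_dvd_sq_of_sq_dvd D Nat.prime_three h9
  rcases relIndex_dvd_of_not_two_dvd W D hodd with ⟨-, h'⟩ | ⟨-, h'⟩ | ⟨ha, h'⟩ | ⟨-, h'⟩ | ⟨-, h'⟩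
  · exact Or.inl (eq_one_of_dvd_of_dvd h h' (by norm_num))
  · exact Or.inl (eq_one_of_dvd_of_dvd h h' (by norm_num))
  · exact Or.inr ⟨ha, h'⟩
  · exact Or.inl (eq_one_of_dvd_of_dvd h h' (by norm_num))
  · exact Or.inl h'

/-- `9 ∣ N`, `2 ∤ N`, `a₂(W) ≠ 0` ⟹ `Λ₁(f) = Λ₀(f)`. [cite: LingOesterle1991, §1 and Thm. 6] -/
theorem periodLatticeGamma1_eq_of_nine_dvd_of_frobeniusTrace_two_ne_zero (D : ModularParametrizationData W N)
    (h9 : 3 ^ 2 ∣ N) (hodd : ¬ 2 ∣ N) (ha : W.frobeniusTrace 2 ≠ 0) : periodLatticeGamma1 D.f = periodLattice D.f := by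
  rcases relIndex_eq_one_or_dvd_nine_of_not_two_dvd W D h9 hodd with h | ⟨ha', -⟩
  · exact le_antisymm (periodLatticeGamma1_le_periodLattice D.f) (AddSubgroup.relIndex_eq_one.mp h)
  · exact absurd ha' ha

/-! ## §4 The classification -/

/-- **TRACELESS SQUARES — THE CLASSIFICATION.**  `W` globally minimal, `D` any `X₀(N)`-datum, `q` an odd prime with `q² ∣ N`.
Then `Λ₁(f) = Λ₀(f)`, OR one of the three exceptional cells holds:
`q = 3`, `2 ∤ N`, `a₂(W) = 0`, `[Λ₀ : Λ₁] ∣ 9` · `q = 3`, `2 ∥ N`, `a₂(f) = −1`, `[Λ₀ : Λ₁] ∣ 9` · `q = 5`, `2 ∤ N`, `a₂(W) = −2`,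
`[Λ₀ : Λ₁] ∣ 25`.  (E15: 281 classes, 279 trivial, the two non-trivial ones `27a1`, `54a1` in cells one and two.)
[cite: LingOesterle1991, §1 and Thm. 6] [cite: AtkinLehner1970, Thm. 3] [cite: SilvermanAEC2009, Thm. V.1.1] -/
theorem relIndex_eq_one_or_exceptional_of_odd_sq_dvd (D : ModularParametrizationData W N) {q : ℕ} (hq : q.Prime)
    (hq2 : q ≠ 2) (hsq : q ^ 2 ∣ N) :
    (periodLatticeGamma1 D.f).relIndex (periodLattice D.f) = 1 ∨
    (q = 3 ∧ ¬ 2 ∣ N ∧ W.frobeniusTrace 2 = 0 ∧ (periodLatticeGamma1 D.f).relIndex (periodLattice D.f) ∣ 9) ∨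
    (q = 3 ∧ 2 ∣ N ∧ ¬ 2 ^ 2 ∣ N ∧ cuspCoeff D.f 2 = -1 ∧ (periodLatticeGamma1 D.f).relIndex (periodLattice D.f) ∣ 9) ∨
    (q = 5 ∧ ¬ 2 ∣ N ∧ W.frobeniusTrace 2 = -2 ∧ (periodLatticeGamma1 D.f).relIndex (periodLattice D.f) ∣ 25) := by
  rcases Nat.lt_or_ge q 7 with hlt | hge
  · interval_cases q
    · exact absurd hq (by norm_num)
    · exact absurd hq (by norm_num)
    · exact absurd rfl hq2
    · -- `q = 3`
      by_cases h2 : 2 ∣ N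
      · by_cases h4 : 2 ^ 2 ∣ N
        · exact Or.inl (relIndex_eq_one_of_nine_dvd_of_four_dvd D hsq h4)
        · rcases relIndex_eq_one_or_dvd_nine_of_two_dvd_of_not_four_dvd D hsq h2 h4 with ⟨-, h⟩ | ⟨ha, h⟩
          · exact Or.inl h
          · exact Or.inr (Or.inr (Or.inl ⟨rfl, h2, h4, ha, h⟩))
      · rcases relIndex_eq_one_or_dvd_nine_of_not_two_dvd W D hsq h2 with h | ⟨ha, h⟩
        · exact Or.inl h
        · exact Or.inr (Or.inl ⟨rfl, h2, ha, h⟩)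
    · exact absurd hq (by norm_num)
    · -- `q = 5`
      by_cases h2 : 2 ∣ N
      · exact Or.inl (relIndex_eq_one_of_twentyFive_dvd_of_two_dvd D hsq h2)
      · rcases relIndex_eq_one_or_dvd_twentyFive_of_not_two_dvd W D hsq h2 with h | ⟨ha, h⟩
        · exact Or.inl h
        · exact Or.inr (Or.inr (Or.inr ⟨rfl, h2, ha, h⟩))
    · exact absurd hq (by norm_num)
  · exact Or.inl (relIndex_eq_one_of_sq_dvd_of_seven_le W D hq hge hsq)

/-- **Coarse form**: `q` odd prime, `q² ∣ N` ⟹ `[Λ₀(f) : Λ₁(f)] = 1`, or `q ∈ {3, 5}` and `[Λ₀(f) : Λ₁(f)] ∣ q²` with `4 ∤ N`.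
[cite: LingOesterle1991, §1 and Thm. 6] -/
theorem relIndex_eq_one_or_dvd_sq_of_odd_sq_dvd (D : ModularParametrizationData W N) {q : ℕ} (hq : q.Prime)
    (hq2 : q ≠ 2) (hsq : q ^ 2 ∣ N) :
    (periodLatticeGamma1 D.f).relIndex (periodLattice D.f) = 1 ∨
      ((q = 3 ∨ q = 5) ∧ ¬ 2 ^ 2 ∣ N ∧ (periodLatticeGamma1 D.f).relIndex (periodLattice D.f) ∣ q ^ 2) := by
  rcases relIndex_eq_one_or_exceptional_of_odd_sq_dvd W D hq hq2 hsq with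
      h | ⟨rfl, h2, -, h⟩ | ⟨rfl, -, h4, -, h⟩ | ⟨rfl, h2, -, h⟩
  · exact Or.inl h
  · exact Or.inr ⟨Or.inl rfl, fun h4 ↦ h2 ((dvd_pow_self 2 two_ne_zero).trans h4), by simpa using h⟩
  · exact Or.inr ⟨Or.inl rfl, h4, by simpa using h⟩
  · exact Or.inr ⟨Or.inr rfl, fun h4 ↦ h2 ((dvd_pow_self 2 two_ne_zero).trans h4), by simpa using h⟩

/-! ## §5 Level instances (E15 values in brackets) -/

/-- `N = 98 = 2·7²`: `[Λ₀ : Λ₁] = 1` for every datum of a minimal curve [E15: `98a ↦ 1`]. [cite: LingOesterle1991, Thm. 6] -/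
theorem relIndex_eq_one_ninetyEight_datum (D : ModularParametrizationData W 98) :
    (periodLatticeGamma1 D.f).relIndex (periodLattice D.f) = 1 :=
  relIndex_eq_one_of_sq_dvd_of_seven_le W D (q := 7) (by norm_num) le_rfl (by norm_num)

/-- `N = 245 = 5·7²`: `[Λ₀ : Λ₁] = 1` for every datum of a minimal curve [E15: `245a, b, c ↦ 1`]. [cite: LingOesterle1991, Thm. 6] -/
theorem relIndex_eq_one_twoFortyFive_datum (D : ModularParametrizationData W 245) :
    (periodLatticeGamma1 D.f).relIndex (periodLattice D.f) = 1 :=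
  relIndex_eq_one_of_sq_dvd_of_seven_le W D (q := 7) (by norm_num) le_rfl (by norm_num)

/-- `N = 75 = 3·5²` (odd): `[Λ₀ : Λ₁] = 1 ∨ (a₂(W) = −2 ∧ [Λ₀ : Λ₁] ∣ 25)` [E15: `75a, b, c ↦ 1`]. [cite: LingOesterle1991, Thm. 6] -/
theorem relIndex_eq_one_or_seventyFive_datum (D : ModularParametrizationData W 75) :
    (periodLatticeGamma1 D.f).relIndex (periodLattice D.f) = 1 ∨
      (W.frobeniusTrace 2 = -2 ∧ (periodLatticeGamma1 D.f).relIndex (periodLattice D.f) ∣ 25) :=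
  relIndex_eq_one_or_dvd_twentyFive_of_not_two_dvd W D (by norm_num) (by norm_num)

end Minimal

section Instances

variable {W₀ : WeierstrassCurve ℚ}

/-- `N = 50 = 2·5²`: `[Λ₀ : Λ₁] = 1` for every datum [E15: `50a, 50b ↦ 1`]. [cite: LingOesterle1991, Thm. 6] -/
theorem relIndex_eq_one_fifty_datum (D₀ : ModularParametrizationData W₀ 50) :
    (periodLatticeGamma1 D₀.f).relIndex (periodLattice D₀.f) = 1 :=
  relIndex_eq_one_of_twentyFive_dvd_of_two_dvd D₀ (by norm_num) (by norm_num)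

/-- `N = 150 = 2·3·5²`: `[Λ₀ : Λ₁] = 1` for every datum [E15: `150a, b, c ↦ 1`]. [cite: LingOesterle1991, Thm. 6] -/
theorem relIndex_eq_one_oneFifty_datum (D₀ : ModularParametrizationData W₀ 150) :
    (periodLatticeGamma1 D₀.f).relIndex (periodLattice D₀.f) = 1 :=
  relIndex_eq_one_of_twentyFive_dvd_of_two_dvd D₀ (by norm_num) (by norm_num)

/-- `N = 54 = 2·3³` (C3): `(a₂(f) = 1 ∧ [Λ₀ : Λ₁] = 1) ∨ (a₂(f) = −1 ∧ [Λ₀ : Λ₁] ∣ 9)` for every datum [E15: `54a ↦ 3`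
(`a₂ = −1`), `54b ↦ 1` (`a₂ = 1`)]. [cite: LingOesterle1991, Thm. 6] [cite: AtkinLehner1970, Thm. 3] -/
theorem relIndex_eq_one_or_dvd_nine_fiftyFour_datum (D₀ : ModularParametrizationData W₀ 54) :
    (cuspCoeff D₀.f 2 = 1 ∧ (periodLatticeGamma1 D₀.f).relIndex (periodLattice D₀.f) = 1) ∨
      (cuspCoeff D₀.f 2 = -1 ∧ (periodLatticeGamma1 D₀.f).relIndex (periodLattice D₀.f) ∣ 9) :=
  relIndex_eq_one_or_dvd_nine_of_two_dvd_of_not_four_dvd D₀ (by norm_num) (by norm_num) (by norm_num)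

end Instances

end Summit.BirchSwinnertonDyer.BirchSwinnertonDyer.Theorems.ManinLocalTwoThree.ShimuraIndex

end
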